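import Literature.Claims.NS.PinheiroQueiroz2025
import Mathlib.Analysis.SpecialFunctions.Pow.Real
import Mathlib.Analysis.SpecialFunctions.ExpDeriv
import HarnessLib

/-!
# C152 `PinheiroQueiroz2025` — refuter kit (ns-claims-refuter-1 g4, refuter of record)

Skeleton `Literature/Claims/NS/PinheiroQueiroz2025.lean` (typist-4 g5, p525774; text of record = census
pin `census/texts/PinheiroQueiroz2025/` p001–p014).

Kernel object, EVERY `K : Constants` (all values of the printed constants `A, B > 0` of §6.4 and `C` of
§6.3):
* `not_Step4_Majorant K : ¬ Step4_Majorant K` — §6.5 «Solution Behavior» p.7 l.22–32 «The solution to the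
  Riccati-type inequality behaves as: y(t) ≤ y(0)B/((B − Ay(0))e^{−Bt} + Ay(0)). As t → ∞: y(t) → B/A»,
  binder `h4` of `claim_of_steps` (the LOAD-BEARING step: it is what turns the §6.4 inequality into the
  uniform `H^s` bound of §6.6 / §10.2). Witness (at `ν = 1`, `s = 3`, horizon `T = 2`, time `t = 1`): the
  CONSTANT function `y ≡ c`, `c = (B/A)² + B/A + 1`, is non-negative, continuous, differentiable, and
  satisfies the printed inequality `y′ = 0 ≤ −Bc + A c√c` (because `√c ≥ B/A`), yet `c` exceeds the printed
  majorant at every `t > 0` (the majorant is `< c` as soon as `e^{−Bt} < 1`, since `Ac > B`). The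
  inequality `y′ ≤ −By + Ay^{3/2}` has the unstable equilibrium `(B/A)²`; above it nothing bounds `y` —
  the displayed closed form is the solution formula of the LOGISTIC right side `−By + Ay²` read as an
  upper bound for all data, which it is not.
[cite: PinheiroQueiroz2025, §6.5 p.7 l.22–32]

WHAT THIS IS NOT: not a claim about NS regularity or blow-up; not a claim about any author beyond the
typed locator.
-/

set_option linter.dupNamespace false

noncomputable section

open Real Set

namespace Summit.NavierStokesRegularity.NavierStokesRegularity.Theorems.PinheiroQueiroz2025

open Literature.Claims.NS.PinheiroQueiroz2025

/-- The constant witness `c = (B/A)² + B/A + 1`. [folklore] -/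
def cW (A B : ℝ) : ℝ := (B / A) ^ 2 + B / A + 1

/-- `c > 0`. [folklore] -/
theorem cW_pos (A B : ℝ) : 0 < cW A B := by
  unfold cW; nlinarith [sq_nonneg (B / A + 1 / 2)]

/-- `c > B/A`. [folklore] -/
theorem cW_gt (A B : ℝ) : B / A < cW A B := by
  unfold cW; nlinarith [sq_nonneg (B / A)]

/-- `c ≥ (B/A)²`. [folklore] -/
theorem cW_ge_sq {A B : ℝ} (hA : 0 < A) (hB : 0 < B) : (B / A) ^ 2 ≤ cW A B := by
  unfold cW; nlinarith [div_pos hB hA]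

/-- The constant `c` satisfies the printed Riccati-type inequality: `0 ≤ −B c + A (c √c)`. [folklore] -/
theorem riccati_const_sqrt {A B : ℝ} (hA : 0 < A) (hB : 0 < B) :
    0 ≤ -B * cW A B + A * (cW A B * Real.sqrt (cW A B)) := by
  set c := cW A B with hc
  have hsqrt : B / A ≤ Real.sqrt c := by
    rw [show B / A = Real.sqrt ((B / A) ^ 2) by rw [Real.sqrt_sq (div_pos hB hA).le]]
    exact Real.sqrt_le_sqrt (cW_ge_sq hA hB)
  have : B * c ≤ A * (c * Real.sqrt c) := by
    calc B * c = A * (c * (B / A)) := by field_simp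
      _ ≤ A * (c * Real.sqrt c) := by have := cW_pos A B; gcongr
  linarith

/-- The printed majorant is violated by the constant at every `t > 0`: `majorant A B c t < c`. [folklore] -/
theorem majorant_lt_const {A B t : ℝ} (hA : 0 < A) (hB : 0 < B) (ht : 0 < t) :
    majorant A B (cW A B) t < cW A B := by
  unfold majorant
  set c := cW A B with hc
  have hcpos : 0 < c := cW_pos A B
  have hAc : B < A * c := by
    have := cW_gt A B; rw [← hc] at this
    rwa [div_lt_iff₀ hA, mul_comm] at this
  have hexp1 : Real.exp (-B * t) < 1 := by
    rw [Real.exp_lt_one_iff]; nlinarith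
  have hexp0 : 0 < Real.exp (-B * t) := Real.exp_pos _
  have hD : B < (B - A * c) * Real.exp (-B * t) + A * c := by nlinarith
  have hDpos : 0 < (B - A * c) * Real.exp (-B * t) + A * c := hB.trans hD
  rw [div_lt_iff₀ hDpos]
  nlinarith

/-- **`¬ Step4_Majorant K` (§6.5 p.7 l.22–32)**, every `K`: at `ν = 1`, `s = 3`, `T = 2`, the constant
`y ≡ c(K.A 1 3, K.B 1 3)` meets every typed hypothesis and exceeds the printed majorant at `t = 1`.
[cite: PinheiroQueiroz2025, §6.5 p.7 l.22–32] -/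
theorem not_Step4_Majorant (K : Constants) : ¬ Step4_Majorant K := by
  intro h
  have hs : (5 : ℝ) / 2 < 3 := by norm_num
  have hA : 0 < K.A 1 3 := K.A_pos 1 3 one_pos hs
  have hB : 0 < K.B 1 3 := K.B_pos 1 3 one_pos hs
  set c : ℝ := cW (K.A 1 3) (K.B 1 3) with hc
  have key := h 1 one_pos 3 hs (fun _ => c) 2 continuousOn_const (fun _ _ => (cW_pos _ _).le)
    (fun t _ => ⟨differentiableAt_const c, by
      rw [deriv_const]
      exact riccati_const_sqrt hA hB⟩) 1 ⟨zero_le_one, one_lt_two⟩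
  exact absurd key (not_le.mpr (majorant_lt_const hA hB one_pos))

/-! ## FQN guard -/

example (K : Literature.Claims.NS.PinheiroQueiroz2025.Constants) :
    ¬ Literature.Claims.NS.PinheiroQueiroz2025.Step4_Majorant K := not_Step4_Majorant K

/-- info: 'Summit.NavierStokesRegularity.NavierStokesRegularity.Theorems.PinheiroQueiroz2025.not_Step4_Majorant' depends on axioms: [propext,
 Classical.choice,
 Quot.sound] -/
#guard_msgs in
#print axioms Summit.NavierStokesRegularity.NavierStokesRegularity.Theorems.PinheiroQueiroz2025.not_Step4_Majorant

end Summit.NavierStokesRegularity.NavierStokesRegularity.Theorems.PinheiroQueiroz2025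

end
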